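import Literature.NumberTheory.Transcendental.PadicExpBallProofs
import Literature.NumberTheory.Transcendental.PadicSchwarzLemma
import Literature.NumberTheory.Transcendental.SixExponentialsProofs
import HarnessLib

/-!
# The `ℓ`-adic six exponentials theorem (Schneider's method over an `ℓ`-adic field)

Everything in this file is **proved**; there are no definitions and no named facts.

**Theorem** (`SixExpPadic.six_exponentials_padic`; Lang, *Introduction to transcendental
numbers* (1966), Ch. II §1, Thm. 1 and §2 ("the `p`-adic case"); Serre, *Abelian `ℓ`-adic
representations and elliptic curves* (1968), Ch. III, Appendix / §3 (Lang's transcendence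
statement used for the local algebraicity theorem); Waldschmidt, *Diophantine Approximation on
Linear Algebraic Groups*, §1.4).  Let `E` be a complete ultrametric normed field which is a
normed `ℚ_ℓ`-algebra.  *If `x₁, x₂ ∈ E` are `ℤ`-linearly independent, `y₁, y₂, y₃ ∈ E` are
`ℤ`-linearly independent, all of norm `≤ ℓ⁻¹`, then at least one of the six numbers
`exp (xᵢ yⱼ)` is transcendental over `ℚ`.*  (The normalisation `‖xᵢ‖, ‖yⱼ‖ ≤ ℓ⁻¹` is harmless:
`exp (xᵢyⱼ)` only depends on the products, and the hypothesis can always be reached by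
rescaling `x ↦ ℓ^a x`, `y ↦ ℓ^{-a} y` once the products are small.)

The proof is the tree's proof of the complex six exponentials theorem
(`SixExponentials.lean`, `SixExponentialsProofs.lean`: Schneider's method as in Waldschmidt
2009, §3.1.5) transported to `E`:

* the number field `K = ℚ(exp(xᵢyⱼ)) ⊆ E`, a common denominator `d` and the algebraic integers
  `δᵢⱼ = d exp(xᵢyⱼ)`; the matrix `M_T(k, λ) = ∏ δᵢⱼ^{λᵢkⱼ} d^{LT-λᵢkⱼ} ∈ 𝓞 K` of the linear
  system, whose image in `E` is `d^{6LT} exp(w(λ) z(k))`, `w(λ) = ∑ λᵢxᵢ`, `z(k) = ∑ kⱼyⱼ`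
  (`coe_M`), and Siegel's lemma over `𝓞 K` with `L = 4u³`, `S₀ = 2u²` (`exists_solution`,
  verbatim from the complex file, through the tree's `siegel_house`);
* the *upper bound* is the tree's **ultrametric Schwarz lemma**
  (`PadicSchwarzLemma.norm_tsum_mul_pow_le_mul_prod`): the auxiliary function
  `F(t) = ∑ p(λ) exp(w(λ)t) = ∑ bₙ tⁿ` has `‖bₙ‖ ≤ 1` on the unit disc (`hasSum_F`,
  `norm_coeff_le_one`, from `PadicExpBallProofs`), and all lattice points `z(k)` lie in the
  disc `‖t‖ ≤ ℓ⁻¹`, so `T³` forced zeros give `‖F(z(k))‖ ≤ ℓ^{-T³}` — no growth factor at all;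
* the *lower bound* is the **`ℓ`-adic Liouville inequality** `‖τ ξ‖_E ≥ B^{-[K:ℚ]}` for a
  non-zero algebraic integer `ξ` all of whose complex conjugates are `≤ B`
  (`liouville_padic`: `N(ξ) = ξ · η` with `η` integral, `|N(ξ)|_ℓ ≥ 1/|N(ξ)|_∞`);
* extrapolation `T → T + 1` and the numerical contradiction `ℓ^{T³} ≤ exp(T³/2)` reuse the
  complex file's `SixExp.param_ineq`, `SixExp.W_le` (with `X = Y = 0`) and
  `SixExp.exp_half_cube_lt_two_pow`;
* the endgame is Artin's independence of characters, the characters `k ↦ exp(w(λ)z(k))` of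
  `ℕ³` being distinct because `exp` is *injective* on the ball (`PadicExp.exp_injOn`) — the
  `ℓ`-adic proof needs no `2πi` bookkeeping.

It is the transcendence input of the local algebraicity of `ℓ`-adic characters of `ℤ_ℓˣ` with
algebraic values at three primes (`GaloisRepresentations/PadicCharacterLocallyAlgebraicProofs.lean`),
hence of Ribet's proof of the irreducibility of the `λ`-adic representations attached to
newforms (Ribet 1977, Thm. (2.3), via Serre's Ch. III §3).

## References

* S. Lang, *Introduction to transcendental numbers*, Addison-Wesley 1966, Ch. II §1 Thm. 1,
  §2. [Lang1966]
* J.-P. Serre, *Abelian ℓ-adic representations and elliptic curves*, Benjamin 1968, Ch. III §3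
  and the transcendence statement quoted there. [SerreAbelianLadic1968]
* M. Waldschmidt, *Auxiliary functions in transcendental number theory*, Ramanujan J. 20
  (2009), §3.1.5. [Waldschmidt2009]
-/

noncomputable section

open NormedSpace Finset NumberField Filter Topology
open scoped Nat

namespace Literature.NumberTheory.Transcendental

namespace SixExpPadic

variable {ℓ : ℕ} [Fact ℓ.Prime] {E : Type} [NontriviallyNormedField E] [NormedAlgebra ℚ_[ℓ] E]
  [IsUltrametricDist E] [CompleteSpace E]

/-! ### Ultrametric bookkeeping -/

omit [Fact ℓ.Prime] [NormedAlgebra ℚ_[ℓ] E] [CompleteSpace E] in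
/-- A finite sum of elements of norm `< r` has norm `< r` (`r > 0`). [folklore] -/
theorem norm_sum_lt_of_forall_lt {ι : Type*} (s : Finset ι) (f : ι → E) {r : ℝ} (hr : 0 < r)
    (h : ∀ i ∈ s, ‖f i‖ < r) : ‖∑ i ∈ s, f i‖ < r := by
  classical
  induction s using Finset.induction_on with
  | empty => simpa using hr
  | insert i s hi ih =>
    rw [Finset.sum_insert hi]
    refine (IsUltrametricDist.norm_add_le_max _ _).trans_lt (max_lt (h i (by simp)) ?_)
    exact ih fun j hj => h j (Finset.mem_insert_of_mem hj)

omit [CompleteSpace E] in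
/-- `‖∑ nᵢ aᵢ‖ ≤ ℓ⁻¹` for natural numbers `nᵢ` when all `‖aᵢ‖ ≤ ℓ⁻¹`. [folklore] -/
theorem norm_sum_natCast_mul_le {ι : Type*} (s : Finset ι) (a : ι → E) (n : ι → ℕ)
    (ha : ∀ i ∈ s, ‖a i‖ ≤ (ℓ : ℝ)⁻¹) : ‖∑ i ∈ s, (n i : E) * a i‖ ≤ (ℓ : ℝ)⁻¹ := by
  refine IsUltrametricDist.norm_sum_le_of_forall_le_of_nonneg (by positivity) fun i hi => ?_
  rw [norm_mul]
  exact (mul_le_of_le_one_left (norm_nonneg _) (PadicExp.norm_natCast_le_one (ℓ := ℓ) _)).trans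
    (ha i hi)

/-- `exp (∑ nᵢ aᵢ) = ∏ (exp aᵢ)^{nᵢ}` on the ball `‖aᵢ‖ < ℓ⁻¹`. [folklore] -/
theorem exp_sum_natCast_mul {ι : Type*} (s : Finset ι) (a : ι → E) (n : ι → ℕ)
    (ha : ∀ i ∈ s, ‖a i‖ < (ℓ : ℝ)⁻¹) :
    exp (∑ i ∈ s, (n i : E) * a i) = ∏ i ∈ s, exp (a i) ^ n i := by
  classical
  induction s using Finset.induction_on with
  | empty => simp
  | insert i s hi ih =>
    have hp : ℓ.Prime := Fact.out
    have hr : (0 : ℝ) < (ℓ : ℝ)⁻¹ := inv_pos.mpr (by exact_mod_cast hp.pos)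
    have hterm : ∀ j ∈ insert i s, ‖(n j : E) * a j‖ < (ℓ : ℝ)⁻¹ := fun j hj => by
      rw [norm_mul]
      exact (mul_le_of_le_one_left (norm_nonneg _)
        (PadicExp.norm_natCast_le_one (ℓ := ℓ) _)).trans_lt (ha j hj)
    have h1 : ‖(n i : E) * a i‖ < (ℓ : ℝ)⁻¹ := hterm i (by simp)
    have h2 : ‖∑ j ∈ s, (n j : E) * a j‖ < (ℓ : ℝ)⁻¹ :=
      norm_sum_lt_of_forall_lt s _ hr fun j hj => hterm j (mem_insert_of_mem hj)
    rw [sum_insert hi, prod_insert hi, PadicExp.exp_add h1 h2,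
      PadicExp.exp_natCast_mul (ha i (by simp)), ih fun j hj => ha j (mem_insert_of_mem hj)]

/-! ### Algebraic integers in `E` and the `ℓ`-adic Liouville inequality -/

omit [CompleteSpace E] in
include ℓ in
/-- An algebraic integer of `E` has norm `≤ 1` (ultrametric: in `aⁿ = -∑_{i<n} cᵢ aⁱ` the right
side is smaller than `‖a‖ⁿ` when `‖a‖ > 1`). [folklore] -/
theorem norm_le_one_of_isIntegral {a : E} (ha : IsIntegral ℤ a) : ‖a‖ ≤ 1 := by
  obtain ⟨P, hPm, hPa⟩ := ha
  by_contra h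
  rw [not_le] at h
  have ha1 : 1 ≤ ‖a‖ := h.le
  set n := P.natDegree with hn
  have hsum : a ^ n = -∑ i ∈ range n, ((P.coeff i : ℤ) : E) * a ^ i := by
    have h2 : Polynomial.eval₂ (algebraMap ℤ E) a P = 0 := hPa
    rw [Polynomial.eval₂_eq_sum_range, sum_range_succ, ← hn] at h2
    have hlead : P.coeff n = 1 := hPm.coeff_natDegree
    rw [hlead, map_one, one_mul] at h2
    simp only [algebraMap_int_eq, eq_intCast] at h2
    linear_combination h2
  rcases Nat.eq_zero_or_pos n with hn0 | hnpos
  · rw [hn0, pow_zero, sum_range_zero, neg_zero] at hsum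
    exact one_ne_zero hsum
  have hbound : ‖∑ i ∈ range n, ((P.coeff i : ℤ) : E) * a ^ i‖ ≤ ‖a‖ ^ (n - 1) := by
    refine IsUltrametricDist.norm_sum_le_of_forall_le_of_nonneg (by positivity) fun i hi => ?_
    rw [mem_range] at hi
    rw [norm_mul, norm_pow]
    calc ‖((P.coeff i : ℤ) : E)‖ * ‖a‖ ^ i ≤ 1 * ‖a‖ ^ i :=
          mul_le_mul_of_nonneg_right (PadicExp.norm_intCast_le_one (ℓ := ℓ) _) (by positivity)
      _ ≤ ‖a‖ ^ (n - 1) := by rw [one_mul]; exact pow_le_pow_right₀ ha1 (by omega)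
  have hlt : ‖a‖ ^ (n - 1) < ‖a‖ ^ n := pow_lt_pow_right₀ h (by omega)
  have : ‖a ^ n‖ ≤ ‖a‖ ^ (n - 1) := by rw [hsum, norm_neg]; exact hbound
  rw [norm_pow] at this
  exact absurd (this.trans_lt hlt) (lt_irrefl _)

omit [IsUltrametricDist E] [CompleteSpace E] in
include ℓ in
/-- `‖n‖_E ≥ 1/n` for a positive natural number `n` (`ℓ^{v_ℓ(n)} ≤ n`). [folklore] -/
theorem inv_natCast_le_norm_natCast {n : ℕ} (hn : n ≠ 0) : (n : ℝ)⁻¹ ≤ ‖(n : E)‖ := by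
  have hp : ℓ.Prime := Fact.out
  rw [PadicExp.norm_natCast (ℓ := ℓ)]
  have hn' : (n : ℚ_[ℓ]) ≠ 0 := Nat.cast_ne_zero.mpr hn
  rw [Padic.norm_eq_zpow_neg_valuation hn', Padic.valuation_natCast, zpow_neg, zpow_natCast]
  have hpow : (0 : ℝ) < (ℓ : ℝ) ^ padicValNat ℓ n := pow_pos (by exact_mod_cast hp.pos) _
  exact inv_anti₀ hpow
    (by exact_mod_cast Nat.le_of_dvd (Nat.pos_of_ne_zero hn) pow_padicValNat_dvd)

omit [CompleteSpace E] in
include ℓ in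
/-- **The `ℓ`-adic Liouville inequality.**  Let `K` be a number field, `τ : K →+* E`, and
`ξ ∈ 𝓞 K` non-zero with all complex conjugates `|σ ξ| ≤ B`, `B ≥ 1`.  Then
`‖τ ξ‖ ≥ B^{-[K:ℚ]}`: the norm `N = N_{K/ℚ}(ξ)` is a non-zero integer with `|N| ≤ B^{[K:ℚ]}`,
`N = ξ η` with `η = N/ξ` an algebraic integer (its image under a complex embedding is the
product of the other conjugates), so `‖τ ξ‖ ≥ ‖τ ξ‖ ‖τ η‖ = |N|_ℓ ≥ 1/|N|`.
(Waldschmidt, *Diophantine Approximation on Linear Algebraic Groups*, §3.5.) [folklore] -/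
theorem liouville_padic {K : Type} [Field K] [NumberField K] (τ : K →+* E) {ξ : 𝓞 K}
    (hξ : ξ ≠ 0) {B : ℝ} (hB : 1 ≤ B) (hc : ∀ σ : K →+* ℂ, ‖σ (ξ : K)‖ ≤ B) :
    (B ^ Module.finrank ℚ K)⁻¹ ≤ ‖τ (ξ : K)‖ := by
  classical
  -- the norm `N ∈ ℤ`, non-zero
  set N : ℤ := Algebra.norm ℤ ξ with hNdef
  have hN0 : N ≠ 0 := Algebra.norm_ne_zero_iff.mpr hξ
  have hNK : ((N : ℚ) : K) = algebraMap ℚ K (Algebra.norm ℚ (ξ : K)) := by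
    rw [hNdef, Algebra.coe_norm_int]; rfl
  have hξ0 : (ξ : K) ≠ 0 := fun h => hξ (RingOfIntegers.coe_eq_zero_iff.mp h)
  -- complex size of `N`
  have hNC : ‖(N : ℂ)‖ ≤ B ^ Module.finrank ℚ K := by
    have h1 : (N : ℂ) = algebraMap ℚ ℂ (Algebra.norm ℚ (ξ : K)) := by
      rw [hNdef, ← Algebra.coe_norm_int]; simp
    rw [h1, Algebra.norm_eq_prod_embeddings ℚ ℂ (ξ : K), norm_prod, ← AlgHom.card ℚ K ℂ,
      ← card_univ, ← prod_const]
    refine prod_le_prod (fun _ _ => norm_nonneg _) fun σ _ => ?_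
    exact hc σ.toRingHom
  -- the cofactor `η = N / ξ` is an algebraic integer
  have hηint : IsIntegral ℤ ((N : K) / (ξ : K)) := by
    obtain ⟨σr⟩ : Nonempty (K →+* ℂ) := inferInstance
    set σ₀ : K →ₐ[ℚ] ℂ := σr.toRatAlgHom with hσ₀
    rw [← isIntegral_algHom_iff (σ₀.toRingHom.toIntAlgHom) σ₀.toRingHom.injective]
    change IsIntegral ℤ (σ₀ ((N : K) / (ξ : K)))
    have hprod : σ₀ ((N : K) / (ξ : K)) = ∏ σ ∈ univ.erase σ₀, σ (ξ : K) := by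
      have h1 : σ₀ (N : K) = ∏ σ : K →ₐ[ℚ] ℂ, σ (ξ : K) := by
        rw [← Algebra.norm_eq_prod_embeddings ℚ ℂ (ξ : K), ← Rat.cast_intCast (α := K) N, hNK,
          AlgHom.commutes]
      rw [map_div₀, h1, ← mul_prod_erase univ (fun σ : K →ₐ[ℚ] ℂ => σ (ξ : K)) (mem_univ σ₀),
        mul_div_cancel_left₀ _ ((map_ne_zero σ₀).mpr hξ0)]
    rw [hprod]
    exact IsIntegral.prod _ fun σ _ => (RingOfIntegers.isIntegral_coe ξ).map σ.toRingHom.toIntAlgHom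
  -- `ℓ`-adic sizes
  have hη1 : ‖τ ((N : K) / (ξ : K))‖ ≤ 1 :=
    norm_le_one_of_isIntegral (ℓ := ℓ) (hηint.map τ.toIntAlgHom)
  have hNE : (B ^ Module.finrank ℚ K)⁻¹ ≤ ‖τ (N : K)‖ := by
    rw [map_intCast]
    obtain ⟨m, hm⟩ : ∃ m : ℕ, N.natAbs = m := ⟨_, rfl⟩
    have hm0 : m ≠ 0 := by rw [← hm]; exact Int.natAbs_ne_zero.mpr hN0
    have h1 : ((N.natAbs : ℕ) : ℝ)⁻¹ ≤ ‖(N : E)‖ := by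
      have hN : (N : E) = (m : E) ∨ (N : E) = -(m : E) := by
        rcases Int.natAbs_eq N with h | h
        · left; rw [h, hm]; push_cast; ring
        · right; rw [h, hm]; push_cast; ring
      rw [hm]
      rcases hN with h | h
      · rw [h]; exact inv_natCast_le_norm_natCast (ℓ := ℓ) hm0
      · rw [h, norm_neg]; exact inv_natCast_le_norm_natCast (ℓ := ℓ) hm0
    refine le_trans ?_ h1
    have hNpos : (0 : ℝ) < (N.natAbs : ℕ) := by positivity
    rw [inv_le_inv₀ (by positivity) hNpos]
    calc ((N.natAbs : ℕ) : ℝ) = ‖(N : ℂ)‖ := by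
          rw [Complex.norm_intCast, Nat.cast_natAbs, Int.cast_abs]
      _ ≤ B ^ Module.finrank ℚ K := hNC
  -- combine
  have hfac : τ (N : K) = τ (ξ : K) * τ ((N : K) / (ξ : K)) := by
    rw [← map_mul, mul_div_cancel₀ _ hξ0]
  calc (B ^ Module.finrank ℚ K)⁻¹ ≤ ‖τ (N : K)‖ := hNE
    _ = ‖τ (ξ : K)‖ * ‖τ ((N : K) / (ξ : K))‖ := by rw [hfac, norm_mul]
    _ ≤ ‖τ (ξ : K)‖ * 1 := mul_le_mul_of_nonneg_left hη1 (norm_nonneg _)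
    _ = ‖τ (ξ : K)‖ := mul_one _

/-! ### The number field generated by the six values: denominators -/

/-- A common denominator for finitely many elements of a number field. [folklore] -/
theorem exists_den {K : Type} [Field K] [NumberField K] {ι : Type*} [Fintype ι] (g : ι → K) :
    ∃ d : ℤ, d ≠ 0 ∧ ∀ i, IsIntegral ℤ ((d : K) * g i) := by
  have h1 : ∀ i, ∃ y : ℤ, y ≠ 0 ∧ IsIntegral ℤ ((y : K) * g i) := by
    intro i
    have hQ : IsAlgebraic ℚ (g i) := Algebra.IsAlgebraic.isAlgebraic _
    have hz : IsAlgebraic ℤ (g i) := (IsFractionRing.isAlgebraic_iff ℤ ℚ K).mpr hQ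
    obtain ⟨y, hy, hint⟩ := hz.exists_integral_multiple
    exact ⟨y, hy, by simpa [zsmul_eq_mul] using hint⟩
  choose y hy hint using h1
  classical
  refine ⟨∏ i, y i, prod_ne_zero_iff.mpr fun i _ => hy i, fun i => ?_⟩
  rw [← mul_prod_erase univ y (mem_univ i)]
  push_cast
  rw [mul_comm ((y i : K)) _, mul_assoc]
  have h2 : IsIntegral ℤ (((∏ j ∈ univ.erase i, y j : ℤ) : K)) := by
    exact_mod_cast isIntegral_algebraMap (R := ℤ) (A := K) (x := ∏ j ∈ univ.erase i, y j)
  simpa using h2.mul (hint i)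

/-! ### The set-up over an abstract number field `K ⊆ E` -/

section Setup

variable {K : Type} [Field K] [NumberField K] (τ : K →+* E) (x : Fin 2 → E) (y : Fin 3 → E)
  (d : ℤ) (δ : Fin 2 → Fin 3 → 𝓞 K)

/-- The values of the exponentials at lattice points are monomials in the `exp(xᵢyⱼ)`:
`exp (w(λ) z(k)) = ∏ᵢⱼ exp(xᵢyⱼ)^{λᵢkⱼ}` (functional equation on the ball). [folklore] -/
theorem exp_w_mul_z (hxn : ∀ i, ‖x i‖ ≤ (ℓ : ℝ)⁻¹) (hyn : ∀ j, ‖y j‖ ≤ (ℓ : ℝ)⁻¹)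
    (L : ℕ) (l : Fin 2 → Fin L) (k : Fin 3 → ℕ) :
    exp ((∑ i, ((l i : ℕ) : E) * x i) * (∑ j, ((k j : ℕ) : E) * y j)) =
      ∏ i, ∏ j, exp (x i * y j) ^ ((l i : ℕ) * k j) := by
  have hp : ℓ.Prime := Fact.out
  have hℓ1 : (1 : ℝ) < ℓ := by exact_mod_cast hp.one_lt
  have hxy : ∀ i j, ‖x i * y j‖ < (ℓ : ℝ)⁻¹ := by
    intro i j
    rw [norm_mul]
    have h1 : ‖x i‖ * ‖y j‖ ≤ (ℓ : ℝ)⁻¹ * (ℓ : ℝ)⁻¹ :=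
      mul_le_mul (hxn i) (hyn j) (norm_nonneg _) (by positivity)
    refine h1.trans_lt ?_
    have h0 : (0 : ℝ) < (ℓ : ℝ)⁻¹ := inv_pos.mpr (by exact_mod_cast hp.pos)
    calc (ℓ : ℝ)⁻¹ * (ℓ : ℝ)⁻¹ < (ℓ : ℝ)⁻¹ * 1 :=
          mul_lt_mul_of_pos_left (inv_lt_one_of_one_lt₀ hℓ1) h0
      _ = (ℓ : ℝ)⁻¹ := mul_one _
  have hsum : (∑ i, ((l i : ℕ) : E) * x i) * (∑ j, ((k j : ℕ) : E) * y j) =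
      ∑ ij : Fin 2 × Fin 3, ((((l ij.1 : ℕ) * k ij.2 : ℕ)) : E) * (x ij.1 * y ij.2) := by
    rw [sum_mul_sum, ← univ_product_univ, sum_product]
    refine sum_congr rfl fun i _ => sum_congr rfl fun j _ => ?_
    push_cast; ring
  rw [hsum, exp_sum_natCast_mul (ℓ := ℓ) univ _ _ fun ij _ => hxy ij.1 ij.2,
    ← univ_product_univ, prod_product]

variable {τ x y d δ}

omit [NumberField K] in
/-- **The matrix entries in `E`**: if `τ δᵢⱼ = d exp(xᵢyⱼ)` then
`τ (∏ᵢⱼ δᵢⱼ^{λᵢkⱼ} d^{LT-λᵢkⱼ}) = d^{6LT} exp(w(λ) z(k))` on the box `kⱼ < T`. [folklore] -/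
theorem coe_M (hxn : ∀ i, ‖x i‖ ≤ (ℓ : ℝ)⁻¹) (hyn : ∀ j, ‖y j‖ ≤ (ℓ : ℝ)⁻¹)
    (hδ : ∀ i j, τ (δ i j : K) = (d : E) * exp (x i * y j))
    (L T : ℕ) (k : Fin 3 → Fin T) (l : Fin 2 → Fin L) :
    τ ((∏ i, ∏ j, δ i j ^ ((l i : ℕ) * (k j : ℕ)) *
        (d : 𝓞 K) ^ (L * T - (l i : ℕ) * (k j : ℕ)) : 𝓞 K) : K) =
      (d : E) ^ (6 * (L * T)) *
        exp ((∑ i, ((l i : ℕ) : E) * x i) * (∑ j, (((k j : ℕ) : ℕ) : E) * y j)) := by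
  rw [exp_w_mul_z (ℓ := ℓ) x y hxn hyn L l (fun j => (k j : ℕ))]
  have hD : (d : E) ^ (6 * (L * T)) = ∏ _i : Fin 2, ∏ _j : Fin 3, (d : E) ^ (L * T) := by
    simp only [prod_const, card_univ, Fintype.card_fin, ← pow_mul]; ring_nf
  have hδ' : ∀ i j, τ (algebraMap (𝓞 K) K (δ i j)) = (d : E) * exp (x i * y j) := hδ
  have hd' : τ (algebraMap (𝓞 K) K (d : 𝓞 K)) = (d : E) := by simp
  rw [hD, ← prod_mul_distrib, RingOfIntegers.coe_eq_algebraMap]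
  simp only [map_prod, map_mul, map_pow]
  refine prod_congr rfl fun i _ => ?_
  rw [← prod_mul_distrib]
  refine prod_congr rfl fun j _ => ?_
  have hle : (l i : ℕ) * (k j : ℕ) ≤ L * T := SixExpRat.Setup.le_mul_of_fin (l i) (k j)
  rw [hδ', hd', mul_pow]
  conv_rhs => rw [← Nat.add_sub_cancel' hle, pow_add]
  ring

omit [NumberField K] in
/-- `d^{6LT} F(z(k)) = τ ((M_T p)(k))` for the auxiliary function
`F(t) = ∑ τ(p(λ)) exp(w(λ)t)`. [folklore] -/
theorem D_mul_F (hxn : ∀ i, ‖x i‖ ≤ (ℓ : ℝ)⁻¹) (hyn : ∀ j, ‖y j‖ ≤ (ℓ : ℝ)⁻¹)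
    (hδ : ∀ i j, τ (δ i j : K) = (d : E) * exp (x i * y j)) (L T : ℕ)
    (M : Matrix (Fin 3 → Fin T) (Fin 2 → Fin L) (𝓞 K))
    (hM : ∀ k l, M k l = ∏ i, ∏ j, δ i j ^ ((l i : ℕ) * (k j : ℕ)) *
        (d : 𝓞 K) ^ (L * T - (l i : ℕ) * (k j : ℕ)))
    (p : (Fin 2 → Fin L) → 𝓞 K) (k : Fin 3 → Fin T) :
    (d : E) ^ (6 * (L * T)) *
        ∑ l, τ (p l : K) * exp ((∑ i, ((l i : ℕ) : E) * x i) * (∑ j, (((k j : ℕ) : ℕ) : E) * y j)) =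
      τ ((Matrix.mulVec M p k : 𝓞 K) : K) := by
  rw [Matrix.mulVec, dotProduct, mul_sum]
  push_cast
  simp only [map_sum, map_mul]
  refine sum_congr rfl fun l _ => ?_
  rw [hM, coe_M (ℓ := ℓ) hxn hyn hδ L T k l]
  ring

/-! ### Sizes of conjugates (as in the complex proof) -/

omit [Fact ℓ.Prime] [NontriviallyNormedField E] [NormedAlgebra ℚ_[ℓ] E] [IsUltrametricDist E]
  [CompleteSpace E] [NumberField K] in
/-- The conjugates of the matrix entries are bounded by `C₀^{6LT}` when `|σ δᵢⱼ|, |d| ≤ C₀`.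
[folklore] -/
theorem norm_embedding_M_le {C₀ : ℝ} (hC₀ : 1 ≤ C₀) (hδC : ∀ (σ : K →+* ℂ) i j, ‖σ (δ i j : K)‖ ≤ C₀)
    (hdC : |(d : ℝ)| ≤ C₀) (L T : ℕ) (k : Fin 3 → Fin T) (l : Fin 2 → Fin L) (σ : K →+* ℂ) :
    ‖σ ((∏ i, ∏ j, δ i j ^ ((l i : ℕ) * (k j : ℕ)) *
        (d : 𝓞 K) ^ (L * T - (l i : ℕ) * (k j : ℕ)) : 𝓞 K) : K)‖ ≤ C₀ ^ (6 * (L * T)) := by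
  rw [← SixExp.Setup.prod_prod_const]
  push_cast
  simp only [map_prod, map_mul, map_pow, norm_prod, norm_mul, norm_pow, map_intCast,
    Complex.norm_intCast]
  refine prod_le_prod (fun i _ => by positivity) fun i _ => ?_
  refine prod_le_prod (fun j _ => by positivity) fun j _ => ?_
  have hle : (l i : ℕ) * (k j : ℕ) ≤ L * T := SixExpRat.Setup.le_mul_of_fin (l i) (k j)
  have h0 : 0 ≤ C₀ := zero_le_one.trans hC₀
  calc ‖σ (δ i j : K)‖ ^ ((l i : ℕ) * (k j : ℕ)) * |(d : ℝ)| ^ (L * T - (l i : ℕ) * (k j : ℕ))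
      ≤ C₀ ^ ((l i : ℕ) * (k j : ℕ)) * C₀ ^ (L * T - (l i : ℕ) * (k j : ℕ)) :=
        mul_le_mul (pow_le_pow_left₀ (norm_nonneg _) (hδC σ i j) _)
          (pow_le_pow_left₀ (abs_nonneg _) hdC _) (by positivity) (by positivity)
    _ = C₀ ^ (L * T) := by rw [← pow_add, Nat.add_sub_cancel' hle]

omit [Fact ℓ.Prime] [NontriviallyNormedField E] [NormedAlgebra ℚ_[ℓ] E] [IsUltrametricDist E]
  [CompleteSpace E] in
/-- `house x ≤ B` from a bound on all conjugates. [folklore] -/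
theorem house_le_of_forall_norm_le {v : K} {B : ℝ} (hB : 0 ≤ B)
    (hx : ∀ σ : K →+* ℂ, ‖σ v‖ ≤ B) : house v ≤ B := by
  rw [house, pi_norm_le_iff_of_nonneg hB]
  exact fun σ => hx σ

omit [Fact ℓ.Prime] [NontriviallyNormedField E] [NormedAlgebra ℚ_[ℓ] E] [IsUltrametricDist E]
  [CompleteSpace E] in
/-- The conjugates of `(M_T p)(k)` are bounded by `L² C₀^{6LT} P` when `house p(λ) ≤ P`.
[folklore] -/
theorem norm_embedding_mulVec_le {C₀ : ℝ} (hC₀ : 1 ≤ C₀)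
    (hδC : ∀ (σ : K →+* ℂ) i j, ‖σ (δ i j : K)‖ ≤ C₀) (hdC : |(d : ℝ)| ≤ C₀) (L T : ℕ)
    (M : Matrix (Fin 3 → Fin T) (Fin 2 → Fin L) (𝓞 K))
    (hM : ∀ k l, M k l = ∏ i, ∏ j, δ i j ^ ((l i : ℕ) * (k j : ℕ)) *
        (d : 𝓞 K) ^ (L * T - (l i : ℕ) * (k j : ℕ)))
    (p : (Fin 2 → Fin L) → 𝓞 K) {P : ℝ} (hP : ∀ l, house ((p l : 𝓞 K) : K) ≤ P)
    (k : Fin 3 → Fin T) (σ : K →+* ℂ) :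
    ‖σ ((Matrix.mulVec M p k : 𝓞 K) : K)‖ ≤ (L : ℝ) ^ 2 * (C₀ ^ (6 * (L * T)) * P) := by
  rw [Matrix.mulVec, dotProduct]
  push_cast
  simp only [map_sum, map_mul]
  refine (norm_sum_le _ _).trans ?_
  have hterm : ∀ l : Fin 2 → Fin L,
      ‖σ (M k l : K) * σ (p l : K)‖ ≤ C₀ ^ (6 * (L * T)) * P := by
    intro l
    rw [norm_mul]
    have hP0 : 0 ≤ P := (house_nonneg _).trans (hP l)
    refine mul_le_mul ?_ ((NumberField.norm_embedding_le_house _ σ).trans (hP l)) (norm_nonneg _)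
      (by positivity)
    rw [hM]
    exact norm_embedding_M_le hC₀ hδC hdC L T k l σ
  calc ∑ l, ‖σ (M k l : K) * σ (p l : K)‖
      ≤ ∑ _l : Fin 2 → Fin L, C₀ ^ (6 * (L * T)) * P := sum_le_sum fun l _ => hterm l
    _ = (L : ℝ) ^ 2 * (C₀ ^ (6 * (L * T)) * P) := by
        rw [sum_const, card_univ, Fintype.card_fun, Fintype.card_fin, Fintype.card_fin, nsmul_eq_mul]
        push_cast
        ring

omit [Fact ℓ.Prime] [NontriviallyNormedField E] [NormedAlgebra ℚ_[ℓ] E] [IsUltrametricDist E]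
  [CompleteSpace E] in
/-- **Siegel's lemma step** (verbatim from the complex proof: `L = 4u³`, `S₀ = 2u²`,
`L² = 2S₀³` unknowns, `S₀³` equations, exponent `1`): a non-zero `p ∈ 𝓞 K^{L²}` with
`M_{S₀} p = 0` and `house p(λ) ≤ C_K (C_K L² C₀^{6LS₀})`. [cite: Waldschmidt2009, §3.1 Lemma 3.1] -/
theorem exists_solution {C₀ : ℝ} (hC₀ : 1 ≤ C₀)
    (hδC : ∀ (σ : K →+* ℂ) i j, ‖σ (δ i j : K)‖ ≤ C₀) (hdC : |(d : ℝ)| ≤ C₀)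
    (u : ℕ) (hu : 1 ≤ u) {L S₀ : ℕ} (hL : L = 4 * u ^ 3) (hS₀ : S₀ = 2 * u ^ 2)
    (M : Matrix (Fin 3 → Fin S₀) (Fin 2 → Fin L) (𝓞 K))
    (hM : ∀ k l, M k l = ∏ i, ∏ j, δ i j ^ ((l i : ℕ) * (k j : ℕ)) *
        (d : 𝓞 K) ^ (L * S₀ - (l i : ℕ) * (k j : ℕ))) :
    ∃ p : (Fin 2 → Fin L) → 𝓞 K, p ≠ 0 ∧ Matrix.mulVec M p = 0 ∧
      ∀ l, house ((p l : 𝓞 K) : K) ≤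
        siegelConst K * (siegelConst K * ((L ^ 2 : ℕ) : ℝ) * C₀ ^ (6 * (L * S₀))) := by
  have hm : Fintype.card (Fin 3 → Fin S₀) = S₀ ^ 3 := by simp
  have hn : Fintype.card (Fin 2 → Fin L) = L ^ 2 := by simp
  have hLS : L ^ 2 = 2 * S₀ ^ 3 := by rw [hL, hS₀]; ring
  have hS₀pos : 0 < S₀ := by rw [hS₀]; positivity
  have hLpos : 0 < L := by rw [hL]; positivity
  have hcard_lt : S₀ ^ 3 < L ^ 2 := by
    rw [hLS]; have := pow_pos hS₀pos 3; omega
  have hcard_pos : 0 < S₀ ^ 3 := by positivity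
  haveI : Nonempty (Fin 2 → Fin L) := ⟨fun _ => ⟨0, hLpos⟩⟩
  have hA : (1 : ℝ) ≤ C₀ ^ (6 * (L * S₀)) := one_le_pow₀ hC₀
  have hhouse : ∀ k l, house (algebraMap (𝓞 K) K (M k l)) ≤ C₀ ^ (6 * (L * S₀)) := by
    intro k l
    refine house_le_of_forall_norm_le (by positivity) fun σ => ?_
    rw [hM]
    exact norm_embedding_M_le hC₀ hδC hdC L S₀ k l σ
  obtain ⟨p, hp0, hMp, hhouse⟩ := siegel_house K M hcard_pos hcard_lt hm hn hA hhouse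
  refine ⟨p, hp0, hMp, fun l => ?_⟩
  have hexp : (((S₀ ^ 3 : ℕ) : ℝ) / (((L ^ 2 : ℕ) : ℝ) - ((S₀ ^ 3 : ℕ) : ℝ))) = 1 := by
    rw [hLS]
    push_cast
    have : (0 : ℝ) < (S₀ : ℝ) ^ 3 := by positivity
    field_simp
    ring
  have h := hhouse l
  rwa [hexp, Real.rpow_one] at h

/-! ### The auxiliary function as a power series on the unit disc -/

variable (τ x) in
omit [NumberField K] in
/-- **The auxiliary function is a power series with coefficients of norm `≤ 1`.**  For
`‖xᵢ‖ ≤ ℓ⁻¹`, `p(λ) ∈ 𝓞 K` and `‖t‖ < 1`,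
`F(t) = ∑_λ τ(p λ) exp(w(λ) t) = ∑ₙ bₙ tⁿ` with `bₙ = ∑_λ τ(p λ) w(λ)ⁿ / n!`. [folklore] -/
theorem hasSum_F (hxn : ∀ i, ‖x i‖ ≤ (ℓ : ℝ)⁻¹) (L : ℕ) (p : (Fin 2 → Fin L) → 𝓞 K)
    {t : E} (ht : ‖t‖ < 1) :
    HasSum (fun n : ℕ => (∑ l, τ (p l : K) * (∑ i, ((l i : ℕ) : E) * x i) ^ n / (n ! : E)) * t ^ n)
      (∑ l, τ (p l : K) * exp ((∑ i, ((l i : ℕ) : E) * x i) * t)) := by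
  have hp : ℓ.Prime := Fact.out
  have hw : ∀ l : Fin 2 → Fin L, ‖(∑ i, ((l i : ℕ) : E) * x i) * t‖ < (ℓ : ℝ)⁻¹ := by
    intro l
    rw [norm_mul]
    have h1 := norm_sum_natCast_mul_le (ℓ := ℓ) univ x (fun i => (l i : ℕ)) fun i _ => hxn i
    have h0 : (0 : ℝ) < (ℓ : ℝ)⁻¹ := inv_pos.mpr (by exact_mod_cast hp.pos)
    calc ‖∑ i, ((l i : ℕ) : E) * x i‖ * ‖t‖ ≤ (ℓ : ℝ)⁻¹ * ‖t‖ :=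
          mul_le_mul_of_nonneg_right h1 (norm_nonneg _)
      _ < (ℓ : ℝ)⁻¹ * 1 := mul_lt_mul_of_pos_left ht h0
      _ = (ℓ : ℝ)⁻¹ := mul_one _
  have hterm : ∀ l : Fin 2 → Fin L, HasSum
      (fun n : ℕ => τ (p l : K) * (∑ i, ((l i : ℕ) : E) * x i) ^ n / (n ! : E) * t ^ n)
      (τ (p l : K) * exp ((∑ i, ((l i : ℕ) : E) * x i) * t)) := by
    intro l
    have h := (PadicExp.hasSum_exp (hw l)).mul_left (τ (p l : K))
    refine h.congr_fun fun n => ?_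
    rw [mul_pow]; ring
  have := hasSum_sum fun l (_ : l ∈ (univ : Finset (Fin 2 → Fin L))) => hterm l
  refine this.congr_fun fun n => ?_
  rw [sum_mul]

omit [CompleteSpace E] [NumberField K] in
/-- The coefficients `bₙ = ∑_λ τ(p λ) w(λ)ⁿ/n!` have norm `≤ 1` (`‖τ p(λ)‖ ≤ 1`,
`‖w(λ)‖ⁿ/‖n!‖ ≤ ℓ^{-n} ℓ^{n-1} ≤ 1`). [folklore] -/
theorem norm_coeff_le_one (hxn : ∀ i, ‖x i‖ ≤ (ℓ : ℝ)⁻¹) (L : ℕ) (p : (Fin 2 → Fin L) → 𝓞 K)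
    (n : ℕ) : ‖∑ l, τ (p l : K) * (∑ i, ((l i : ℕ) : E) * x i) ^ n / (n ! : E)‖ ≤ 1 := by
  have hp : ℓ.Prime := Fact.out
  have hℓ : (1 : ℝ) ≤ ℓ := by exact_mod_cast hp.one_lt.le
  have hℓ0 : (0 : ℝ) < ℓ := by exact_mod_cast hp.pos
  refine IsUltrametricDist.norm_sum_le_of_forall_le_of_nonneg zero_le_one fun l _ => ?_
  rw [mul_div_assoc, norm_mul]
  have h1 : ‖τ (p l : K)‖ ≤ 1 :=
    norm_le_one_of_isIntegral (ℓ := ℓ) ((RingOfIntegers.isIntegral_coe (p l)).map τ.toIntAlgHom)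
  have h2 : ‖(∑ i, ((l i : ℕ) : E) * x i) ^ n / (n ! : E)‖ ≤ 1 := by
    refine (PadicExp.norm_pow_div_factorial_le (ℓ := ℓ) _ n).trans ?_
    have hw := norm_sum_natCast_mul_le (ℓ := ℓ) univ x (fun i => (l i : ℕ)) fun i _ => hxn i
    calc ‖∑ i, ((l i : ℕ) : E) * x i‖ ^ n * (ℓ : ℝ) ^ (n - 1)
        ≤ ((ℓ : ℝ)⁻¹) ^ n * (ℓ : ℝ) ^ (n - 1) :=
          mul_le_mul_of_nonneg_right (pow_le_pow_left₀ (norm_nonneg _) hw n) (by positivity)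
      _ ≤ ((ℓ : ℝ)⁻¹) ^ n * (ℓ : ℝ) ^ n := by
          refine mul_le_mul_of_nonneg_left (pow_le_pow_right₀ hℓ (Nat.sub_le n 1)) (by positivity)
      _ = 1 := by rw [inv_pow, inv_mul_cancel₀ (by positivity)]
  calc ‖τ (p l : K)‖ * ‖(∑ i, ((l i : ℕ) : E) * x i) ^ n / (n ! : E)‖ ≤ 1 * 1 :=
        mul_le_mul h1 h2 (norm_nonneg _) zero_le_one
    _ = 1 := mul_one _

omit [NumberField K] in
/-- **The ultrametric Schwarz lemma for `F`.**  If `F` vanishes at the points of a finite set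
`s` of the disc `‖a‖ ≤ ℓ⁻¹`, then `‖F(t)‖ ≤ ℓ^{-#s}` for every `‖t‖ ≤ ℓ⁻¹`
(`PadicSchwarzLemma.norm_tsum_mul_pow_le_mul_prod` with coefficient bound `1`, and
`‖t - a‖ ≤ ℓ⁻¹`). [folklore] -/
theorem norm_F_le_of_forall_eq_zero (hxn : ∀ i, ‖x i‖ ≤ (ℓ : ℝ)⁻¹) (L : ℕ)
    (p : (Fin 2 → Fin L) → 𝓞 K) (s : Finset E) (hs : ∀ a ∈ s, ‖a‖ ≤ (ℓ : ℝ)⁻¹)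
    (h0 : ∀ a ∈ s, ∑ l, τ (p l : K) * exp ((∑ i, ((l i : ℕ) : E) * x i) * a) = 0)
    {t : E} (ht : ‖t‖ ≤ (ℓ : ℝ)⁻¹) :
    ‖∑ l, τ (p l : K) * exp ((∑ i, ((l i : ℕ) : E) * x i) * t)‖ ≤ ((ℓ : ℝ)⁻¹) ^ s.card := by
  have hp : ℓ.Prime := Fact.out
  have hℓ1 : (ℓ : ℝ)⁻¹ < 1 := inv_lt_one_of_one_lt₀ (by exact_mod_cast hp.one_lt)
  set b : ℕ → E := fun n => ∑ l, τ (p l : K) * (∑ i, ((l i : ℕ) : E) * x i) ^ n / (n ! : E)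
    with hb
  have hF : ∀ {a : E}, ‖a‖ ≤ (ℓ : ℝ)⁻¹ →
      ∑ l, τ (p l : K) * exp ((∑ i, ((l i : ℕ) : E) * x i) * a) = ∑' n, b n * a ^ n := by
    intro a ha
    exact ((hasSum_F (ℓ := ℓ) τ x hxn L p (ha.trans_lt hℓ1)).tsum_eq).symm
  have hbB : ∀ n, ‖b n‖ ≤ 1 := fun n => norm_coeff_le_one (ℓ := ℓ) hxn L p n
  have hs1 : ∀ a ∈ s, ‖a‖ < 1 := fun a ha => (hs a ha).trans_lt hℓ1
  have hs0 : ∀ a ∈ s, ∑' n, b n * a ^ n = 0 := fun a ha => by rw [← hF (hs a ha)]; exact h0 a ha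
  have h := norm_tsum_mul_pow_le_mul_prod s hbB hs1 hs0 (ht.trans_lt hℓ1)
  rw [hF ht, ← prod_const]
  refine h.trans ?_
  rw [one_mul]
  refine prod_le_prod (fun a _ => norm_nonneg _) fun a ha => ?_
  rw [sub_eq_add_neg]
  exact (IsUltrametricDist.norm_add_le_max t (-a)).trans
    (max_le ht (by rw [norm_neg]; exact hs a ha))

/-! ### Distinct lattice points and distinct characters -/

omit [Fact ℓ.Prime] [NormedAlgebra ℚ_[ℓ] E] [IsUltrametricDist E] [CompleteSpace E] in
/-- An integer combination of a `ℤ`-linearly independent family that vanishes is trivial.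
[folklore] -/
theorem eq_zero_of_sum_intCast_mul_eq_zero {ι : Type*} [Fintype ι] {v : ι → E}
    (hv : LinearIndependent ℤ v) (g : ι → ℤ) (h : ∑ i, (g i : E) * v i = 0) (i : ι) :
    g i = 0 := by
  have h' : ∑ i, g i • v i = 0 := by simpa [zsmul_eq_mul] using h
  exact Fintype.linearIndependent_iff.1 hv g h' i

omit [Fact ℓ.Prime] [NormedAlgebra ℚ_[ℓ] E] [IsUltrametricDist E] [CompleteSpace E] in
/-- Distinct `k` give distinct lattice points `z(k) = ∑ kⱼ yⱼ`. [folklore] -/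
theorem z_injective (hy : LinearIndependent ℤ y) :
    Function.Injective (fun k : Fin 3 → ℕ => ∑ j, ((k j : ℕ) : E) * y j) := by
  intro k k' h
  have h0 : ∑ j, (((k j : ℤ) - (k' j : ℤ) : ℤ) : E) * y j = 0 := by
    have : (∑ j, ((k j : ℕ) : E) * y j) - ∑ j, ((k' j : ℕ) : E) * y j = 0 := sub_eq_zero.2 h
    rw [← sum_sub_distrib] at this
    rw [← this]
    refine sum_congr rfl fun j _ => ?_
    push_cast
    ring
  funext j
  have := eq_zero_of_sum_intCast_mul_eq_zero hy _ h0 j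
  omega

omit [Fact ℓ.Prime] [NormedAlgebra ℚ_[ℓ] E] [IsUltrametricDist E] [CompleteSpace E] in
/-- Distinct `λ` give distinct frequencies `w(λ) = ∑ λᵢ xᵢ`. [folklore] -/
theorem w_injective (hx : LinearIndependent ℤ x) (L : ℕ) :
    Function.Injective (fun l : Fin 2 → Fin L => ∑ i, ((l i : ℕ) : E) * x i) := by
  intro l m h
  have h0 : ∑ i, ((((l i : ℕ) : ℤ) - ((m i : ℕ) : ℤ) : ℤ) : E) * x i = 0 := by
    have : (∑ i, ((l i : ℕ) : E) * x i) - ∑ i, ((m i : ℕ) : E) * x i = 0 := sub_eq_zero.2 h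
    rw [← sum_sub_distrib] at this
    rw [← this]
    refine sum_congr rfl fun i _ => ?_
    push_cast
    ring
  funext i
  have := eq_zero_of_sum_intCast_mul_eq_zero hx _ h0 i
  exact Fin.ext (by omega)

omit [NumberField K] in
/-- **Endgame (Artin's independence of characters).**  If `F(t) = ∑_λ τ(p λ) exp(w(λ)t)`
vanishes at every lattice point `z(k)`, `k ∈ ℕ³`, then `p = 0`: the maps
`k ↦ exp(w(λ) z(k))` are distinct characters of `ℕ³` (additivity of `z` and the functional
equation; distinct because `exp` is injective on the ball and `yⱼ ≠ 0`, `w` injective), hence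
linearly independent (`linearIndependent_monoidHom`). [cite: Waldschmidt2009, §3.1.5] -/
theorem eq_zero_of_forall_F_eq_zero (hx : LinearIndependent ℤ x) (hy : LinearIndependent ℤ y)
    (hxn : ∀ i, ‖x i‖ ≤ (ℓ : ℝ)⁻¹) (hyn : ∀ j, ‖y j‖ ≤ (ℓ : ℝ)⁻¹) (L : ℕ)
    (p : (Fin 2 → Fin L) → 𝓞 K)
    (h : ∀ k : Fin 3 → ℕ,
      ∑ l, τ (p l : K) * exp ((∑ i, ((l i : ℕ) : E) * x i) * (∑ j, ((k j : ℕ) : E) * y j)) = 0) :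
    p = 0 := by
  have hp : ℓ.Prime := Fact.out
  have hℓ1 : (1 : ℝ) < ℓ := by exact_mod_cast hp.one_lt
  have hℓinv : (ℓ : ℝ)⁻¹ < 1 := inv_lt_one_of_one_lt₀ hℓ1
  -- norms: `‖w(λ) z(k)‖ < ℓ⁻¹`
  have hwz : ∀ (l : Fin 2 → Fin L) (k : Fin 3 → ℕ),
      ‖(∑ i, ((l i : ℕ) : E) * x i) * (∑ j, ((k j : ℕ) : E) * y j)‖ < (ℓ : ℝ)⁻¹ := by
    intro l k
    rw [norm_mul]
    have h1 := norm_sum_natCast_mul_le (ℓ := ℓ) univ x (fun i => (l i : ℕ)) fun i _ => hxn i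
    have h2 := norm_sum_natCast_mul_le (ℓ := ℓ) univ y (fun j => k j) fun j _ => hyn j
    have h0 : (0 : ℝ) < (ℓ : ℝ)⁻¹ := inv_pos.mpr (by exact_mod_cast hp.pos)
    calc ‖∑ i, ((l i : ℕ) : E) * x i‖ * ‖∑ j, ((k j : ℕ) : E) * y j‖
        ≤ (ℓ : ℝ)⁻¹ * (ℓ : ℝ)⁻¹ := mul_le_mul h1 h2 (norm_nonneg _) h0.le
      _ < (ℓ : ℝ)⁻¹ * 1 := mul_lt_mul_of_pos_left hℓinv h0
      _ = (ℓ : ℝ)⁻¹ := mul_one _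
  -- the characters
  let chi : (Fin 2 → Fin L) → (Multiplicative (Fin 3 → ℕ) →* E) := fun l =>
    { toFun := fun k => exp ((∑ i, ((l i : ℕ) : E) * x i) *
        (∑ j, ((Multiplicative.toAdd k j : ℕ) : E) * y j))
      map_one' := by simp
      map_mul' := fun k k' => by
        have hadd : (∑ j, ((Multiplicative.toAdd (k * k') j : ℕ) : E) * y j) =
            (∑ j, ((Multiplicative.toAdd k j : ℕ) : E) * y j) +
              ∑ j, ((Multiplicative.toAdd k' j : ℕ) : E) * y j := by
          rw [← sum_add_distrib]
          refine sum_congr rfl fun j _ => ?_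
          rw [toAdd_mul, Pi.add_apply]
          push_cast
          ring
        rw [hadd, mul_add, PadicExp.exp_add (hwz l _) (hwz l _)] }
  have chi_apply : ∀ l (k : Fin 3 → ℕ), chi l (Multiplicative.ofAdd k) =
      exp ((∑ i, ((l i : ℕ) : E) * x i) * (∑ j, ((k j : ℕ) : E) * y j)) := fun l k => rfl
  -- distinctness
  have hinj : Function.Injective chi := by
    intro l m hlm
    have hy0 : y 0 ≠ 0 := hy.ne_zero 0
    have key := congrArg (fun χ : Multiplicative (Fin 3 → ℕ) →* E =>
      χ (Multiplicative.ofAdd (Pi.single 0 1))) hlm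
    simp only [chi_apply] at key
    have hz : (∑ j, (((Pi.single (0 : Fin 3) (1 : ℕ) : Fin 3 → ℕ) j : ℕ) : E) * y j) = y 0 := by
      rw [Fin.sum_univ_three]
      simp
    rw [hz] at key
    have hn : ∀ l : Fin 2 → Fin L, ‖(∑ i, ((l i : ℕ) : E) * x i) * y 0‖ < (ℓ : ℝ)⁻¹ := by
      intro l
      have := hwz l (Pi.single 0 1)
      rwa [hz] at this
    have heq := PadicExp.exp_injOn (hn l) (hn m) key
    have heq' : (∑ i, ((l i : ℕ) : E) * x i) = ∑ i, ((m i : ℕ) : E) * x i :=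
      mul_right_cancel₀ hy0 heq
    exact w_injective hx L heq'
  -- Artin
  have hli := (linearIndependent_monoidHom (Multiplicative (Fin 3 → ℕ)) E).comp chi hinj
  have hsum : ∑ l, τ (p l : K) • ((chi l : Multiplicative (Fin 3 → ℕ) →* E) :
      Multiplicative (Fin 3 → ℕ) → E) = 0 := by
    funext k
    simp only [Finset.sum_apply, Pi.smul_apply, smul_eq_mul, Pi.zero_apply]
    exact h (Multiplicative.toAdd k)
  funext l
  have h1 := Fintype.linearIndependent_iff.1 hli (fun l => τ (p l : K)) hsum l
  have h2 : (p l : K) = 0 := (map_eq_zero τ).mp h1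
  exact RingOfIntegers.coe_eq_zero_iff.1 h2

end Setup

/-! ### The theorem -/

/-- **The `ℓ`-adic six exponentials theorem** (Lang 1966, Ch. II §1 Thm. 1 and §2; the
transcendence statement behind Serre's local algebraicity theorem, *Abelian ℓ-adic
representations*, Ch. III §3).  Let `E` be a complete ultrametric normed field which is a normed
`ℚ_ℓ`-algebra, `x₁, x₂ ∈ E` `ℤ`-linearly independent and `y₁, y₂, y₃ ∈ E` `ℤ`-linearly
independent, all of norm `≤ ℓ⁻¹`.  Then the six numbers `exp(xᵢ yⱼ)` are not all algebraic
(algebraicity is stated over `ℤ`, equivalently over `ℚ`, to avoid fixing a `ℚ`-algebra structure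
on `E` in the statement).  Proof: Schneider's method, see the module docstring. [cite: Lang1966, Ch. II §1 Thm. 1, §2] -/
theorem six_exponentials_padic (x : Fin 2 → E) (y : Fin 3 → E) (hx : LinearIndependent ℤ x)
    (hy : LinearIndependent ℤ y) (hxn : ∀ i, ‖x i‖ ≤ (ℓ : ℝ)⁻¹) (hyn : ∀ j, ‖y j‖ ≤ (ℓ : ℝ)⁻¹)
    (halg : ∀ i j, IsAlgebraic ℤ (exp (x i * y j))) : False := by
  classical
  haveI : CharZero E := charZero_of_injective_algebraMap (algebraMap ℚ_[ℓ] E).injective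
  have halg' : ∀ i j, IsAlgebraic ℚ (exp (x i * y j)) := fun i j =>
    (IsFractionRing.isAlgebraic_iff ℤ ℚ E).mp (halg i j)
  have hp : ℓ.Prime := Fact.out
  have hℓ1 : (1 : ℝ) < ℓ := by exact_mod_cast hp.one_lt
  have hℓ2 : (2 : ℝ) ≤ ℓ := by exact_mod_cast hp.two_le
  have hℓinv : (ℓ : ℝ)⁻¹ < 1 := inv_lt_one_of_one_lt₀ hℓ1
  have hℓinv0 : (0 : ℝ) < (ℓ : ℝ)⁻¹ := inv_pos.mpr (by exact_mod_cast hp.pos)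
  -- ### the number field `K = ℚ(exp(xᵢyⱼ)) ⊆ E`
  set v : Fin 2 × Fin 3 → E := fun ij => exp (x ij.1 * y ij.2) with hv
  set K : IntermediateField ℚ E := IntermediateField.adjoin ℚ (Set.range v) with hKdef
  haveI : FiniteDimensional ℚ K := by
    haveI : Finite (Set.range v) := (Set.finite_range _).to_subtype
    exact IntermediateField.finiteDimensional_adjoin fun z hz => by
      obtain ⟨ij, rfl⟩ := hz
      exact (halg' ij.1 ij.2).isIntegral
  haveI : NumberField K :=
    { to_charZero := charZero_of_injective_algebraMap (algebraMap ℚ K).injective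
      to_finiteDimensional := inferInstance }
  set τ : K →+* E := (algebraMap K E) with hτ
  have genmem : ∀ ij, v ij ∈ K := fun ij => IntermediateField.subset_adjoin _ _ ⟨ij, rfl⟩
  set gen : Fin 2 × Fin 3 → K := fun ij => ⟨v ij, genmem ij⟩ with hgen
  have hτgen : ∀ i j, τ (gen (i, j)) = exp (x i * y j) := fun i j => rfl
  -- ### denominators and the algebraic integers `δᵢⱼ = d exp(xᵢyⱼ)`
  obtain ⟨d, hd0, hdint⟩ := exists_den gen
  set δ : Fin 2 → Fin 3 → 𝓞 K := fun i j => ⟨(d : K) * gen (i, j), hdint (i, j)⟩ with hδdef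
  have hδ : ∀ i j, τ (δ i j : K) = (d : E) * exp (x i * y j) := by
    intro i j
    simp only [hδdef, RingOfIntegers.map_mk, map_mul, map_intCast, hτgen]
  have hdE : (d : E) ≠ 0 := Int.cast_ne_zero.mpr hd0
  have hdE1 : ‖(d : E)‖ ≤ 1 := PadicExp.norm_intCast_le_one (ℓ := ℓ) d
  -- ### sizes of conjugates: `C₀ = |d| (1 + ∑_σ ∑_ij |σ gen ij|)`
  set Mc : ℝ := 1 + ∑ σ : K →+* ℂ, ∑ ij, ‖σ (gen ij)‖ with hMc
  have hMc1 : 1 ≤ Mc := by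
    have : 0 ≤ ∑ σ : K →+* ℂ, ∑ ij, ‖σ (gen ij)‖ := by positivity
    rw [hMc]; linarith
  have hgenC : ∀ (σ : K →+* ℂ) ij, ‖σ (gen ij)‖ ≤ Mc := by
    intro σ ij
    have h1 : ‖σ (gen ij)‖ ≤ ∑ ij', ‖σ (gen ij')‖ :=
      single_le_sum (f := fun ij' => ‖σ (gen ij')‖) (fun _ _ => norm_nonneg _) (mem_univ ij)
    have h2 : ∑ ij', ‖σ (gen ij')‖ ≤ ∑ σ' : K →+* ℂ, ∑ ij', ‖σ' (gen ij')‖ :=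
      single_le_sum (f := fun σ' : K →+* ℂ => ∑ ij', ‖σ' (gen ij')‖) (fun _ _ => by positivity)
        (mem_univ σ)
    rw [hMc]; linarith
  set C₀ : ℝ := |(d : ℝ)| * Mc with hC₀def
  have hd1 : (1 : ℝ) ≤ |(d : ℝ)| := by exact_mod_cast Int.one_le_abs hd0
  have hC₀ : 1 ≤ C₀ := one_le_mul_of_one_le_of_one_le hd1 hMc1
  have hdC : |(d : ℝ)| ≤ C₀ := le_mul_of_one_le_right (abs_nonneg _) hMc1
  have hδC : ∀ (σ : K →+* ℂ) i j, ‖σ (δ i j : K)‖ ≤ C₀ := by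
    intro σ i j
    simp only [hδdef, RingOfIntegers.map_mk, map_mul, map_intCast, norm_mul, Complex.norm_intCast]
    exact mul_le_mul_of_nonneg_left (hgenC σ (i, j)) (abs_nonneg _)
  -- ### the constants
  have hCK : (1 : ℝ) ≤ siegelConst K := one_le_siegelConst K
  set κ₀ : ℝ := 4 + 2 * Real.log (siegelConst K) + 18 * Real.log C₀ + 5 * 0 * 0 with hκ₀def
  have hκ₀ : 0 ≤ κ₀ := by
    have := Real.log_nonneg hC₀
    have := Real.log_nonneg hCK
    rw [hκ₀def]; positivity
  set h : ℕ := Module.finrank ℚ K with hhdef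
  set κ : ℝ := (h + 1) * κ₀ with hκdef
  have hκ : 0 ≤ κ := by positivity
  set u : ℕ := ⌈2 * κ⌉₊ + 1 with hudef
  have hu1 : 1 ≤ u := by omega
  have hκu : 2 * κ ≤ u := by
    calc 2 * κ ≤ ⌈2 * κ⌉₊ := Nat.le_ceil (2 * κ)
      _ ≤ u := by rw [hudef]; push_cast; linarith
  obtain ⟨L, hLdef⟩ : ∃ L : ℕ, L = 4 * u ^ 3 := ⟨_, rfl⟩
  obtain ⟨S₀, hS₀def⟩ : ∃ S₀ : ℕ, S₀ = 2 * u ^ 2 := ⟨_, rfl⟩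
  have hS₀pos : 0 < S₀ := by rw [hS₀def]; positivity
  have hL1 : 1 ≤ L := by rw [hLdef]; have := pow_pos (show 0 < u by omega) 3; omega
  -- ### the matrices `M_T` and Siegel's lemma at level `S₀`
  set M : (T : ℕ) → Matrix (Fin 3 → Fin T) (Fin 2 → Fin L) (𝓞 K) := fun T k l =>
    ∏ i, ∏ j, δ i j ^ ((l i : ℕ) * (k j : ℕ)) * (d : 𝓞 K) ^ (L * T - (l i : ℕ) * (k j : ℕ))
    with hMdef
  have hM : ∀ T k l, M T k l = ∏ i, ∏ j, δ i j ^ ((l i : ℕ) * (k j : ℕ)) *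
      (d : 𝓞 K) ^ (L * T - (l i : ℕ) * (k j : ℕ)) := fun T k l => rfl
  set P : ℝ := siegelConst K * (siegelConst K * ((L ^ 2 : ℕ) : ℝ) * C₀ ^ (6 * (L * S₀))) with hPdef
  obtain ⟨p, hp0, hMp, hhouse⟩ := exists_solution hC₀ hδC hdC u hu1 hLdef hS₀def (M S₀) (hM S₀)
  have hP1 : 1 ≤ P := by
    have hA : (1 : ℝ) ≤ C₀ ^ (6 * (L * S₀)) := one_le_pow₀ hC₀
    have hL2 : (1 : ℝ) ≤ ((L ^ 2 : ℕ) : ℝ) := by exact_mod_cast one_le_pow₀ hL1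
    rw [hPdef]
    exact one_le_mul_of_one_le_of_one_le hCK
      (one_le_mul_of_one_le_of_one_le (one_le_mul_of_one_le_of_one_le hCK hL2) hA)
  -- ### abbreviations for the auxiliary function and the lattice points
  set F : E → E := fun t => ∑ l, τ (p l : K) * exp ((∑ i, ((l i : ℕ) : E) * x i) * t) with hFdef
  set z : (Fin 3 → ℕ) → E := fun k => ∑ j, ((k j : ℕ) : E) * y j with hzdef
  have hznorm : ∀ k : Fin 3 → ℕ, ‖z k‖ ≤ (ℓ : ℝ)⁻¹ := fun k =>
    norm_sum_natCast_mul_le (ℓ := ℓ) univ y k fun j _ => hyn j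
  have hDF : ∀ (T : ℕ) (k : Fin 3 → Fin T),
      (d : E) ^ (6 * (L * T)) * F (z fun j => (k j : ℕ)) =
        τ ((Matrix.mulVec (M T) p k : 𝓞 K) : K) :=
    fun T k => D_mul_F (ℓ := ℓ) hxn hyn hδ L T (M T) (hM T) p k
  -- ### `F` vanishes on the boxes `k_j < T` for every `T ≥ S₀`
  have hvan : ∀ T : ℕ, S₀ ≤ T → ∀ k : Fin 3 → ℕ, (∀ j, k j < T) → F (z k) = 0 := by
    intro T hT
    induction T, hT using Nat.le_induction with
    | base =>
      intro k hk
      have e := hDF S₀ (fun j => ⟨k j, hk j⟩)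
      rw [hMp, Pi.zero_apply] at e
      simp only [map_zero] at e
      have e' : (d : E) ^ (6 * (L * S₀)) * F (z k) = 0 := by
        convert e using 3
      exact (mul_eq_zero.1 e').resolve_left (pow_ne_zero _ hdE)
    | succ T hST ih =>
      intro k hk
      by_contra hne
      have hT1 : 1 ≤ T := le_trans hS₀pos hST
      -- the zeros already known: the box of side `T`, `T³` distinct points of norm `≤ ℓ⁻¹`
      set s : Finset E := univ.image (fun k' : Fin 3 → Fin T => z (fun j => (k' j : ℕ)))
        with hsdef
      have hscard : s.card = T ^ 3 := by
        rw [hsdef, card_image_of_injective, card_univ]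
        · simp
        · intro k₁ k₂ h12
          have := z_injective (y := y) hy h12
          funext j
          exact Fin.ext (congrFun this j)
      have hs : ∀ c ∈ s, ‖c‖ ≤ (ℓ : ℝ)⁻¹ := by
        intro c hc
        rw [hsdef, mem_image] at hc
        obtain ⟨k', -, rfl⟩ := hc
        exact hznorm _
      have h0 : ∀ c ∈ s, F c = 0 := by
        intro c hc
        rw [hsdef, mem_image] at hc
        obtain ⟨k', -, rfl⟩ := hc
        exact ih _ fun j => (k' j).isLt
      -- the upper bound (ultrametric Schwarz lemma with `T³` zeros in the disc `‖t‖ ≤ ℓ⁻¹`)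
      have hup : ‖F (z k)‖ ≤ ((ℓ : ℝ)⁻¹) ^ (T ^ 3) := by
        have := norm_F_le_of_forall_eq_zero (ℓ := ℓ) (τ := τ) hxn L p s hs h0 (hznorm k)
        rwa [hscard] at this
      -- the lower bound (`ℓ`-adic Liouville inequality for the algebraic integer `(M_{T+1} p)(k)`)
      set ξ : 𝓞 K := Matrix.mulVec (M (T + 1)) p (fun j => ⟨k j, hk j⟩) with hξdef
      have hξ : (d : E) ^ (6 * (L * (T + 1))) * F (z k) = τ ((ξ : 𝓞 K) : K) := by
        have := hDF (T + 1) (fun j => ⟨k j, hk j⟩)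
        exact this
      have hξ0 : ξ ≠ 0 := by
        intro h0'
        rw [h0'] at hξ
        simp only [map_zero] at hξ
        exact hne ((mul_eq_zero.1 hξ).resolve_left (pow_ne_zero _ hdE))
      set B : ℝ := (L : ℝ) ^ 2 * (C₀ ^ (6 * (L * (T + 1))) * P) with hBdef
      have hB1 : 1 ≤ B := by
        have hL2 : (1 : ℝ) ≤ (L : ℝ) ^ 2 := one_le_pow₀ (by exact_mod_cast hL1)
        exact one_le_mul_of_one_le_of_one_le hL2
          (one_le_mul_of_one_le_of_one_le (one_le_pow₀ hC₀) hP1)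
      have hconj : ∀ σ : K →+* ℂ, ‖σ ((ξ : 𝓞 K) : K)‖ ≤ B := fun σ =>
        norm_embedding_mulVec_le hC₀ hδC hdC L (T + 1) (M (T + 1)) (hM (T + 1)) p hhouse _ σ
      have hlow : (B ^ h)⁻¹ ≤ ‖τ ((ξ : 𝓞 K) : K)‖ := liouville_padic (ℓ := ℓ) τ hξ0 hB1 hconj
      -- combine: `ℓ^{T³} ≤ B^h`
      have hcomb : (ℓ : ℝ) ^ (T ^ 3) ≤ B ^ h := by
        have h1 : ‖τ ((ξ : 𝓞 K) : K)‖ ≤ ((ℓ : ℝ)⁻¹) ^ (T ^ 3) := by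
          rw [← hξ, norm_mul, norm_pow]
          calc ‖(d : E)‖ ^ (6 * (L * (T + 1))) * ‖F (z k)‖ ≤ 1 * ((ℓ : ℝ)⁻¹) ^ (T ^ 3) :=
                mul_le_mul (pow_le_one₀ (norm_nonneg _) hdE1) hup (norm_nonneg _) zero_le_one
            _ = ((ℓ : ℝ)⁻¹) ^ (T ^ 3) := one_mul _
        have h2 : (B ^ h)⁻¹ ≤ ((ℓ : ℝ) ^ (T ^ 3))⁻¹ := by
          have h12 := hlow.trans h1
          rwa [inv_pow] at h12
        have hBpos : 0 < B ^ h := by positivity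
        have hℓpos : (0 : ℝ) < (ℓ : ℝ) ^ (T ^ 3) := by positivity
        exact (inv_le_inv₀ hBpos hℓpos).mp h2
      -- every factor is at most `W ≤ exp(L T κ₀)`
      set W : ℝ := (L : ℝ) ^ 2 * P * C₀ ^ (6 * (L * (T + 1))) * Real.exp (L * 0 * (5 * (T * 0)))
        with hWdef
      have hBW : B ≤ W := by
        rw [hBdef, hWdef]
        have : (L : ℝ) ^ 2 * (C₀ ^ (6 * (L * (T + 1))) * P) =
            (L : ℝ) ^ 2 * P * C₀ ^ (6 * (L * (T + 1))) * 1 := by ring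
        rw [this]
        refine mul_le_mul_of_nonneg_left ?_ (by positivity)
        simp
      have hW0 : 0 ≤ W := by positivity
      have hWexp : W ≤ Real.exp (L * T * κ₀) := by
        have := SixExp.W_le (T := T) hL1 hS₀pos hST hC₀ hCK (C₀ := C₀) (CK := siegelConst K)
          (X := 0) (Y := 0)
        rw [hWdef, hPdef]
        convert this using 2
      -- the numerical contradiction
      have hfin : (2 : ℝ) ^ (T ^ 3) ≤ Real.exp ((T : ℝ) ^ 3 / 2) :=
        calc (2 : ℝ) ^ (T ^ 3) ≤ (ℓ : ℝ) ^ (T ^ 3) := pow_le_pow_left₀ (by norm_num) hℓ2 _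
          _ ≤ B ^ h := hcomb
          _ ≤ W ^ h := pow_le_pow_left₀ (by positivity) hBW _
          _ ≤ Real.exp (L * T * κ₀) ^ h := pow_le_pow_left₀ hW0 hWexp _
          _ ≤ Real.exp (L * T * κ₀) ^ (h + 1) := by
              refine pow_le_pow_right₀ ?_ (Nat.le_succ h)
              exact Real.one_le_exp (by positivity)
          _ = Real.exp ((h + 1 : ℕ) * (L * T * κ₀)) := by rw [← Real.exp_nat_mul]
          _ ≤ Real.exp ((T : ℝ) ^ 3 / 2) := by
              refine Real.exp_le_exp.2 ?_
              have hTr : (2 : ℝ) * (u : ℝ) ^ 2 ≤ T := by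
                have : ((2 * u ^ 2 : ℕ) : ℝ) ≤ T := by rw [← hS₀def]; exact_mod_cast hST
                push_cast at this
                exact this
              have hLr : (L : ℝ) = 4 * (u : ℝ) ^ 3 := by rw [hLdef]; push_cast; ring
              have key := SixExp.param_ineq hκ hκu hTr
              calc ((h + 1 : ℕ) : ℝ) * (L * T * κ₀) = 4 * (u : ℝ) ^ 3 * T * κ := by
                    rw [hLr, hκdef]; push_cast; ring
                _ ≤ (T : ℝ) ^ 3 / 2 := key
      exact absurd (SixExp.exp_half_cube_lt_two_pow (T := T) (by omega)) (not_lt.2 hfin)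
  -- ### hence `F` vanishes at every lattice point, and Artin's theorem kills the coefficients
  have hall : ∀ k : Fin 3 → ℕ, F (z k) = 0 := fun k =>
    hvan (max S₀ (univ.sup k + 1)) (le_max_left _ _) k fun j =>
      lt_max_of_lt_right (Nat.lt_succ_of_le (le_sup (mem_univ j)))
  exact hp0 (eq_zero_of_forall_F_eq_zero (ℓ := ℓ) hx hy hxn hyn L p hall)

end SixExpPadic

end Literature.NumberTheory.Transcendental

end
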